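import Summits.QuantumAdvantage.QuantumAdvantage.Theorems.WildDialDollB

/-! # WildDialDollC — part 3/4 (mechanical split for landing of `WildDialDoll`; content verbatim; scopes re-opened with their variables) -/

set_option linter.dupNamespace false

namespace Summit.QuantumAdvantage.QuantumAdvantage.Theorems.WildDialDoll
open Finset
open Summit.QuantumAdvantage.AdviceFreeQNC0
open Summit.QuantumAdvantage.AdviceFreeQNC0.Fib19
open Literature.Computability.QuantumComplexity
open Literature.Computability.QuantumComplexity.RingHLF
open Literature.Computability.MetaComplexity

/-! ### §4b ALL ring lengths: the canonical affine base has no affine / quadratic / cubic completion -/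

/-- Doll witnesses for `d = 1` exist at every `n ≥ 8` (bases `8, 9, 10`, period-`3` padding). [PROVED] -/
theorem exists_dollWitness_one : ∀ n, 8 ≤ n → ∃ (x : Fin n → Bool) (T : Fin (2 * 1 + 1) → Finset (Fin n)), DollWitness n 1 x T := by
  intro n
  induction n using Nat.strongRecOn with
  | ind n ih =>
    intro hn
    by_cases h12 : n < 11
    · have : n = 8 ∨ n = 9 ∨ n = 10 := by omega
      rcases this with rfl | rfl | rfl
      · exact ⟨x8, T8, dollWitness_eight⟩
      · exact ⟨x9, T9, dollWitness_nine⟩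
      · exact ⟨x10, T10, dollWitness_ten⟩
    · have h := exists_dollWitness_add_three (ih (n - 3) (by omega) (by omega))
      rwa [show n - 3 + 3 = n by omega] at h

/-- Doll witnesses for `d = 2` exist at every `n ≥ 12` (bases `12, 13, 14`). [PROVED] -/
theorem exists_dollWitness_two : ∀ n, 12 ≤ n → ∃ (x : Fin n → Bool) (T : Fin (2 * 2 + 1) → Finset (Fin n)), DollWitness n 2 x T := by
  intro n
  induction n using Nat.strongRecOn with
  | ind n ih =>
    intro hn
    by_cases h15 : n < 15
    · have : n = 12 ∨ n = 13 ∨ n = 14 := by omega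
      rcases this with rfl | rfl | rfl
      · exact ⟨x12, T12, dollWitness_twelve⟩
      · exact ⟨x13, T13, dollWitness_thirteen⟩
      · exact ⟨x14, T14, dollWitness_fourteen⟩
    · have h := exists_dollWitness_add_three (ih (n - 3) (by omega) (by omega))
      rwa [show n - 3 + 3 = n by omega] at h

/-- Doll witnesses for `d = 3` exist at every `n ≥ 16` (bases `16, 17, 18`). [PROVED] -/
theorem exists_dollWitness_three : ∀ n, 16 ≤ n → ∃ (x : Fin n → Bool) (T : Fin (2 * 3 + 1) → Finset (Fin n)), DollWitness n 3 x T := by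
  intro n
  induction n using Nat.strongRecOn with
  | ind n ih =>
    intro hn
    by_cases h19 : n < 19
    · have : n = 16 ∨ n = 17 ∨ n = 18 := by omega
      rcases this with rfl | rfl | rfl
      · exact ⟨x16, T16, dollWitness_sixteen⟩
      · exact ⟨x17, T17, dollWitness_seventeen⟩
      · exact ⟨x18, T18, dollWitness_eighteen⟩
    · have h := exists_dollWitness_add_three (ih (n - 3) (by omega) (by omega))
      rwa [show n - 3 + 3 = n by omega] at h

/-- **THEOREM (all `n ≥ 8`): `CanonCoinAt n 1`** — no AFFINE wild bit completes the canonical base (an affine-rung fact,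
re-proved here by the doll method as calibration). [PROVED] -/
theorem canonCoinAt_one {n : ℕ} (hn : 8 ≤ n) : CanonCoinAt n 1 := by
  obtain ⟨x, T, hW⟩ := exists_dollWitness_one n hn; exact canonCoinAt_of_dollWitness hW

/-- **THEOREM (all `n ≥ 12`): `CanonCoinAt n 2` — THE ORACLE BIT IS NEVER A QUADRATIC EVENT.** For every ring length
`n ≥ 12`, no wild bit `[P₀ = 1]` with `deg P₀ ≤ 2` completes the canonical affine base to a perfect strategy; equivalently the
coin indicator `t(x)_0 ⊕ ¬J_1(x)` agrees with no quadratic `𝔽₃`-event on the co-pin class.  The first theorem on this summit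
about a quadratic output of UNRESTRICTED rank (lens-2's few-forms theorem needs rank `≤ (n−8)/12 − 2log₂ n`). [PROVED] -/
theorem canonCoinAt_two {n : ℕ} (hn : 12 ≤ n) : CanonCoinAt n 2 := by
  obtain ⟨x, T, hW⟩ := exists_dollWitness_two n hn; exact canonCoinAt_of_dollWitness hW

/-- **THEOREM (all `n ≥ 16`): `CanonCoinAt n 3`** — no CUBIC wild bit completes the canonical base. [PROVED] -/
theorem canonCoinAt_three {n : ℕ} (hn : 16 ≤ n) : CanonCoinAt n 3 := by
  obtain ⟨x, T, hW⟩ := exists_dollWitness_three n hn; exact canonCoinAt_of_dollWitness hW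

/-- **`CanonQuadratic3` = `CanonCoin3` at `d = 2`, the canonical instance of the first open cell — PROVED.**  This is the
cashed bottom of the chain `target ⟹ P1 ⟹ OneQuadratic3 ⟹ (∃ n₀, ∀ n ≥ n₀, CanonCoinAt n 2)`. [PROVED; `n₀ = 12`] -/
theorem canonQuadratic3 : ∃ n₀ : ℕ, ∀ n ≥ n₀, CanonCoinAt n 2 := ⟨12, fun _ hn => canonCoinAt_two hn⟩

/-- The cubic analogue. [PROVED; `n₀ = 16`] -/
theorem canonCubic3 : ∃ n₀ : ℕ, ∀ n ≥ n₀, CanonCoinAt n 3 := ⟨16, fun _ hn => canonCoinAt_three hn⟩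


/-! ### §4c THE UNIFORM DOLL FAMILY (the all-`d` statement `FamilyWitness`, proved in §4e below) -/

/-- **Uniform base**: all ones except ONE zero at position `z`. -/
def famX (N z : ℕ) : Fin N → Bool := fun i => decide (i.val ≠ z)

/-- **Uniform nested doll** with spacing `3` and innermost shell of length `1`: `T_j = {4 + 3j, 12d + 5 − 3j}`, `j ≤ 2d`
(so the shells between consecutive pairs are runs of three `1`s — step sums `≡ 0 (mod 3)` — and the innermost shell has
step sum `∓1`). Needs `N ≥ 12d + 6`. -/
def famT (N d : ℕ) : Fin (2 * d + 1) → Finset (Fin N) :=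
  fun j => (Finset.univ : Finset (Fin N)).filter fun i => i.val = 4 + 3 * j.val ∨ i.val = 12 * d + 5 - 3 * j.val

/-- The position of the zero: `z ∈ {1,2,3}` with `z ≡ 2N + 1 (mod 3)` (tunes the outer shell sum to the residue the oracle
bit needs; NODE-g5.md §3). -/
def famZ (N : ℕ) : ℕ := if (2 * N + 1) % 3 = 0 then 3 else (2 * N + 1) % 3

/-- **THE UNIFORM DOLL FAMILY `FamilyWitness`** — for every `d` and every `N ≥ 12d + 6` the explicit pair
`(famX N (famZ N), famT N d)` is a doll witness.  [PROVED in §4e (`familyWitness_holds`); verified numerically first for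
`d = 1…4` (exp/family.py) and kernel-certified below at `d = 4`, `N = 54, 55, 56` (kept as independent certificates).  With
`canonCoin3_of_familyWitness` it yields `canonCoin3 : CanonCoin3`.] -/
def FamilyWitness : Prop := ∀ d N : ℕ, 12 * d + 6 ≤ N → DollWitness N d (famX N (famZ N)) (famT N d)

/-- **`FamilyWitness → CanonCoin3`** (with `n₀(d) = 12d + 6`). [PROVED] -/
theorem canonCoin3_of_familyWitness (h : FamilyWitness) : CanonCoin3 :=
  fun d => ⟨12 * d + 6, fun N hN => canonCoinAt_of_dollWitness (h d N hN)⟩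


/-! ### §4e `FamilyWitness` PROVED ⟹ **`canonCoin3 : CanonCoin3` for EVERY degree `d`** (all in the tree's monodromy coordinates)

The proof of NODE-g5.md §3: append laws for `reflBit`/`sigmaSum`; the shell word `nest` (its parity, its signed count
`σ(nest cs) = 2·[#flipped shells even]`, and WHERE ITS ZEROS ARE); the bridge `List.ofFn (dollPt famX famT S) = famWord S`; the tuning
`famZ_spec`; the alternating parity sum `Σ_S (−1)^{|S|} g(|S| mod 2) = 2^{2d}(g₀ − g₁) ≠ 0`; assembly `familyWitness`. -/

section Family

/-- WildDial doll helper `reflBit_append` (lens-1 g5 WildDialDoll; see the enclosing section docstring). -/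
theorem reflBit_append : ∀ (l₁ l₂ : List Bool), reflBit (l₁ ++ l₂) = xor (reflBit l₁) (reflBit l₂)
  | [], l₂ => by simp [reflBit]
  | b :: rest, l₂ => by
      rw [List.cons_append, reflBit, reflBit, reflBit_append rest l₂]
      cases reflBit rest <;> cases reflBit l₂ <;> cases b <;> rfl

/-- WildDial doll helper `sigmaSum_append` (lens-1 g5 WildDialDoll; see the enclosing section docstring). -/
theorem sigmaSum_append : ∀ (l₁ l₂ : List Bool),
    sigmaSum (l₁ ++ l₂) = sigmaSum l₂ + (if reflBit l₂ then -sigmaSum l₁ else sigmaSum l₁)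
  | [], l₂ => by simp [sigmaSum]
  | b :: rest, l₂ => by
      rw [List.cons_append, sigmaSum, sigmaSum, sigmaSum_append rest l₂, reflBit_append]
      cases reflBit rest <;> cases reflBit l₂ <;> simp <;> ring

/-- WildDial doll helper `reflBit_replicate_true` (lens-1 g5 WildDialDoll; see the enclosing section docstring). -/
theorem reflBit_replicate_true : ∀ k : ℕ, reflBit (List.replicate k true) = false
  | 0 => rfl
  | k + 1 => by rw [List.replicate_succ, reflBit, reflBit_replicate_true k]; rfl

/-- WildDial doll helper `sigmaSum_replicate_true` (lens-1 g5 WildDialDoll; see the enclosing section docstring). -/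
theorem sigmaSum_replicate_true : ∀ k : ℕ, sigmaSum (List.replicate k true) = (k : ZMod 3)
  | 0 => by simp [sigmaSum]
  | k + 1 => by
      rw [List.replicate_succ, sigmaSum, sigmaSum_replicate_true k, reflBit_replicate_true]
      push_cast; simp

/-- The nested shell word on shell bits `cs` (outermost first): `nest [c] = [c,c]`,
`nest (c :: cs) = c 1 1 (nest cs) 1 1 c`. -/
def nest : List Bool → List Bool
  | [] => []
  | [c] => [c, c]
  | c :: c' :: rest => c :: true :: true :: (nest (c' :: rest) ++ [true, true, c])

/-- WildDial doll helper `nest_cons_cons` (lens-1 g5 WildDialDoll; see the enclosing section docstring). -/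
theorem nest_cons_cons (c c' : Bool) (rest : List Bool) :
    nest (c :: c' :: rest) = c :: true :: true :: (nest (c' :: rest) ++ [true, true, c]) := rfl

/-- WildDial doll helper `length_nest` (lens-1 g5 WildDialDoll; see the enclosing section docstring). -/
theorem length_nest : ∀ cs : List Bool, cs ≠ [] → (nest cs).length = 6 * cs.length - 4
  | [], h => (h rfl).elim
  | [c], _ => rfl
  | c :: c' :: rest, _ => by
      have ih := length_nest (c' :: rest) (by simp)
      rw [nest_cons_cons]
      simp only [List.length_cons, List.length_append, ih, List.length_nil]
      omega

/-- WildDial doll helper `reflBit_nest` (lens-1 g5 WildDialDoll; see the enclosing section docstring). -/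
theorem reflBit_nest : ∀ cs : List Bool, reflBit (nest cs) = false
  | [] => rfl
  | [c] => by cases c <;> rfl
  | c :: c' :: rest => by
      have ih := reflBit_nest (c' :: rest)
      rw [nest_cons_cons, reflBit, reflBit, reflBit, reflBit_append, ih]
      cases c <;> rfl

/-- WildDial doll helper `sigmaSum_nest` (lens-1 g5 WildDialDoll; see the enclosing section docstring). -/
theorem sigmaSum_nest : ∀ cs : List Bool, cs ≠ [] → sigmaSum (nest cs) = if reflBit cs then 0 else 2
  | [], h => (h rfl).elim
  | [c], _ => by cases c <;> decide
  | c :: c' :: rest, _ => by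
      have ih := sigmaSum_nest (c' :: rest) (by simp)
      have hr := reflBit_nest (c' :: rest)
      rw [nest_cons_cons]
      simp only [sigmaSum, reflBit, sigmaSum_append, reflBit_append, ih, hr]
      rcases Bool.eq_false_or_eq_true (reflBit rest) with h | h <;> simp only [h] <;> cases c <;> cases c' <;> decide

/-- WHERE THE ZEROS OF THE SHELL WORD ARE: position `t` of `nest cs` is `false` iff it is one of the two positions
`3j`, `6m − 5 − 3j` of a shell `j` with `c_j = false`. -/
theorem nest_getD_eq_false_iff : ∀ (cs : List Bool) (t : ℕ), cs ≠ [] →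
    ((nest cs).getD t true = false ↔
      ∃ j, j < cs.length ∧ cs.getD j true = false ∧ (t = 3 * j ∨ t = 6 * cs.length - 5 - 3 * j))
  | [], t, h => (h rfl).elim
  | [c], t, _ => by
      rcases t with _ | _ | t
      · simp [nest]
      · simp [nest]
      · simp [nest]
  | c :: c' :: rest, t, _ => by
      have ih := fun t => nest_getD_eq_false_iff (c' :: rest) t (by simp)
      have hlen := length_nest (c' :: rest) (by simp)
      simp only [List.length_cons] at hlen ih ⊢
      rw [nest_cons_cons]
      rcases t with _ | _ | _ | t
      · -- t = 0
        simp only [List.getD_cons_zero]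
        constructor
        · intro hc; exact ⟨0, by omega, by simpa using hc, Or.inl rfl⟩
        · rintro ⟨j, hj, hcj, ht⟩
          rcases ht with ht | ht
          · obtain rfl : j = 0 := by omega
            simpa using hcj
          · omega
      · simp only [List.getD_cons_succ, List.getD_cons_zero]
        simp only [Bool.true_eq_false, false_iff, not_exists, not_and]
        intro j hj _ h; omega
      · simp only [List.getD_cons_succ, List.getD_cons_zero]
        simp only [Bool.true_eq_false, false_iff, not_exists, not_and]
        intro j hj _ h; omega
      · -- t + 3
        simp only [List.getD_cons_succ]
        by_cases hlt : t < (nest (c' :: rest)).length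
        · rw [List.getD_append _ _ _ _ hlt, ih t]
          rw [hlen] at hlt
          constructor
          · rintro ⟨j, hj, hcj, ht⟩
            refine ⟨j + 1, by omega, by simpa using hcj, ?_⟩
            rcases ht with ht | ht
            · left; omega
            · right; omega
          · rintro ⟨j, hj, hcj, ht⟩
            obtain ⟨j', rfl⟩ : ∃ j', j = j' + 1 := by
              rcases j with _ | j'
              · exfalso; rcases ht with ht | ht <;> omega
              · exact ⟨j', rfl⟩
            refine ⟨j', by omega, by simpa using hcj, ?_⟩
            rcases ht with ht | ht
            · left; omega
            · right; omega
        · have hle : (nest (c' :: rest)).length ≤ t := not_lt.mp hlt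
          obtain ⟨u, rfl⟩ : ∃ u, t = (nest (c' :: rest)).length + u := ⟨t - (nest (c' :: rest)).length, by omega⟩
          rw [List.getD_append_right _ _ _ _ (by omega), Nat.add_sub_cancel_left, hlen]
          rcases u with _ | _ | _ | u
          · simp only [List.getD_cons_zero, Bool.true_eq_false, false_iff, not_exists, not_and]
            intro j hj _ h; omega
          · simp only [List.getD_cons_succ, List.getD_cons_zero, Bool.true_eq_false, false_iff, not_exists, not_and]
            intro j hj _ h; omega
          · simp only [List.getD_cons_succ, List.getD_cons_zero]
            constructor
            · intro hc; exact ⟨0, by omega, by simpa using hc, Or.inr (by omega)⟩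
            · rintro ⟨j, hj, hcj, ht⟩
              have : j = 0 := by rcases ht with ht | ht <;> omega
              subst this; simpa using hcj
          · simp only [List.getD_cons_succ, List.getD_nil, Bool.true_eq_false, false_iff, not_exists, not_and]
            intro j hj _ h; omega




/-- The first four letters: ones except the zero at `z`. -/
def B0 (z : ℕ) : List Bool := [decide (0 ≠ z), decide (1 ≠ z), decide (2 ≠ z), decide (3 ≠ z)]
/-- Shell bits: `c_j = ¬[j ∈ S]`. -/
def shellBits (m : ℕ) (S : Finset (Fin m)) : List Bool := List.ofFn fun j : Fin m => !decide (j ∈ S)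
/-- The family word. -/
def famWord (N d z : ℕ) (S : Finset (Fin (2 * d + 1))) : List Bool :=
  B0 z ++ (nest (shellBits (2 * d + 1) S) ++ List.replicate (N - (12 * d + 6)) true)

/-- WildDial doll helper `shellBits_ne_nil` (lens-1 g5 WildDialDoll; see the enclosing section docstring). -/
theorem shellBits_ne_nil (m : ℕ) (hm : 0 < m) (S : Finset (Fin m)) : shellBits m S ≠ [] := by
  apply List.ne_nil_of_length_pos; simp [shellBits, hm]

/-- WildDial doll helper `length_shellBits` (lens-1 g5 WildDialDoll; see the enclosing section docstring). -/
theorem length_shellBits (m : ℕ) (S : Finset (Fin m)) : (shellBits m S).length = m := by simp [shellBits]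

/-- WildDial doll helper `shellBits_getD_eq_false_iff` (lens-1 g5 WildDialDoll; see the enclosing section docstring). -/
theorem shellBits_getD_eq_false_iff (m : ℕ) (S : Finset (Fin m)) (j : ℕ) (hj : j < m) :
    (shellBits m S).getD j true = false ↔ (⟨j, hj⟩ : Fin m) ∈ S := by
  rw [List.getD_eq_getElem _ _ (by simp [shellBits, hj])]
  simp [shellBits]

/-- WildDial doll helper `getD_replicate_true` (lens-1 g5 WildDialDoll; see the enclosing section docstring). -/
theorem getD_replicate_true (k i : ℕ) : (List.replicate k true).getD i true = true := by
  induction k generalizing i with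
  | zero => simp
  | succ k _ => cases i <;> simp [List.replicate_succ]

/-- WildDial doll helper `length_famWord` (lens-1 g5 WildDialDoll; see the enclosing section docstring). -/
theorem length_famWord (N d z : ℕ) (hN : 12 * d + 6 ≤ N) (S : Finset (Fin (2 * d + 1))) : (famWord N d z S).length = N := by
  simp only [famWord, List.length_append, List.length_replicate,
    length_nest _ (shellBits_ne_nil _ (by omega) S), length_shellBits, B0, List.length_cons, List.length_nil]
  omega

/-- WildDial doll helper `mem_biUnion_famT_iff` (lens-1 g5 WildDialDoll; see the enclosing section docstring). -/
theorem mem_biUnion_famT_iff (N d : ℕ) (S : Finset (Fin (2 * d + 1))) (i : Fin N) :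
    i ∈ S.biUnion (famT N d) ↔ ∃ j : ℕ, ∃ hj : j < 2 * d + 1, (⟨j, hj⟩ : Fin (2 * d + 1)) ∈ S ∧
      (i.val = 4 + 3 * j ∨ i.val = 12 * d + 5 - 3 * j) := by
  simp only [famT, mem_biUnion, mem_filter, mem_univ, true_and]
  constructor
  · rintro ⟨j, hjS, h⟩; exact ⟨j.val, j.isLt, hjS, h⟩
  · rintro ⟨j, hj, hjS, h⟩; exact ⟨⟨j, hj⟩, hjS, h⟩


end Family
end Summit.QuantumAdvantage.QuantumAdvantage.Theorems.WildDialDoll
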